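import Mathlib
import Summits.PneNP.PneNP.Theorems.ClusUniversalCertificateCoordGauge

/-!
# Route ClusUniversalCertificate, crux `UniversalCertAll` — path `coord`: registered stub `stub_sliceZeroFreeBlock`

Stub file for `stmt-PneNP-19683` (cell pnp-ideate, route `ClusUniversalCertificate`, rung F-N1; path `coord` of pnp-ideate-p1, skeleton v12
sha16 3864e21c; objects of record `…CoordDefs.lean` p516754 / `…CoordBlkDefs.lean` p519312, namespace `…Theorems.ClusCoord`):
**`stub_sliceZeroFreeBlock`** — the SINGLE-BLOCK ZERO-FREE STEP: if a nonempty block `k` has NO zero on `Y`, the slices of block `k` form a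
block layer family satisfying the block layer inequality.  A corollary of the landed gauge bound
`ClusCoordGauge.peelBlock_slices_of_twisted_le` (`H = 0`): no point of `Y` is fully `k`-twisted — if an optimal flat `A ∋ y` inside `Y` had
block-`k` projection of full rank `bsize k`, that projection would be ALL block-`k`-supported vectors (it lies in their span, of dimension
`≤ bsize k`), in particular it would contain the block-`k` part of `y`, i.e. `π_k d = π_k y` for some `d ∈ A.direction`, and then
`y − d ∈ A ⊆ Y` has block `k` equal to zero — contradicting `Z_k(Y) = 0`.
FRONTIER rung F-N1; the conjecture (`stub_peelZeroRare4`) and the crux are OPEN; nothing here bears on P vs NP.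
-/

set_option linter.dupNamespace false -- `Summit.PneNP.PneNP.…`: summit = sub-problem name (D-0017 single-conjunct layout)

namespace Summit.PneNP.PneNP.Theorems.ClusCoordSliceZeroFree

open Finset
open Summit.PneNP.PneNP.Theorems.ClusCoord (acodim bsize zcount kemb IsBLayerFamily BLayerIneq)
open Summit.PneNP.PneNP.Theorems.ClusCoordZeroFree (blockProj blockProj_apply blockProj_eq_zero_iff)
open Summit.PneNP.PneNP.Theorems.ClusCoordGauge (gaugeMap delBlk Twisted exists_optimal)

variable {M M' n : ℕ}

/-- The zero gauge is the plain block projection. -/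
theorem gaugeMap_zero (blk : Fin M → Fin n) (k : Fin n) (h : (univ.filter fun i => blk i ≠ k).card = M') :
    gaugeMap blk k M' h 0 = blockProj blk k := by
  unfold gaugeMap
  rw [LinearMap.zero_comp, sub_zero]

/-- The span of the unit vectors of block `k`: it has dimension `≤ bsize k` and contains every block-`k`-supported vector. -/
theorem blockSpan_props (blk : Fin M → Fin n) (k : Fin n) :
    Module.finrank (ZMod 2) (Submodule.span (ZMod 2)
        (((univ.filter fun i => blk i = k).image fun i => Pi.single i (1 : ZMod 2)) : Set (Fin M → ZMod 2))) ≤ bsize blk k ∧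
      ∀ v : Fin M → ZMod 2, (∀ i, blk i ≠ k → v i = 0) →
        v ∈ Submodule.span (ZMod 2) (((univ.filter fun i => blk i = k).image fun i => Pi.single i (1 : ZMod 2)) : Set (Fin M → ZMod 2)) := by
  constructor
  · calc Module.finrank (ZMod 2) (Submodule.span (ZMod 2)
          (((univ.filter fun i => blk i = k).image fun i => Pi.single i (1 : ZMod 2)) : Set (Fin M → ZMod 2)))
        ≤ ((univ.filter fun i => blk i = k).image fun i => Pi.single i (1 : ZMod 2)).card := finrank_span_finset_le_card _
      _ ≤ (univ.filter fun i => blk i = k).card := Finset.card_image_le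
      _ = bsize blk k := rfl
  · intro v hv
    rw [pi_eq_sum_univ v]
    refine Submodule.sum_mem _ fun i _ => ?_
    by_cases hi : blk i = k
    · refine Submodule.smul_mem _ _ (Submodule.subset_span ?_)
      rw [Finset.coe_image]
      refine ⟨i, by simp [hi], ?_⟩
      funext j
      simp [Pi.single_apply, eq_comm]
    · rw [hv i hi, zero_smul]
      exact Submodule.zero_mem _

/-- **No zero in block `k` ⇒ no fully `k`-twisted point.** -/
theorem not_twisted_of_zcount_eq_zero (blk : Fin M → Fin n) (Y : Finset (Fin M → ZMod 2)) (k : Fin n)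
    (h : (univ.filter fun i => blk i ≠ k).card = M') (hz : zcount blk k Y = 0) (y : Fin M → ZMod 2) (hy : y ∈ Y) :
    ¬ Twisted blk Y k M' h 0 y := by
  intro ht
  obtain ⟨A, hyA, hAY, hopt⟩ := exists_optimal Y y hy
  have hfull := ht A hyA hAY hopt
  rw [gaugeMap_zero] at hfull
  -- the block-`k` projection of `A.direction` is the whole block-`k`-supported span
  set W := Submodule.span (ZMod 2)
    (((univ.filter fun i => blk i = k).image fun i => Pi.single i (1 : ZMod 2)) : Set (Fin M → ZMod 2)) with hW
  obtain ⟨hWdim, hWsupp⟩ := blockSpan_props blk k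
  have hle : A.direction.map (blockProj blk k) ≤ W := by
    rintro w ⟨v, -, rfl⟩
    apply hWsupp
    intro i hi
    rw [blockProj_apply, if_neg hi]
  have heq : A.direction.map (blockProj blk k) = W :=
    Submodule.eq_of_le_of_finrank_le hle (hWdim.trans hfull)
  -- so the block-`k` part of `y` is `π_k d` for some `d` in the direction
  have hyW : blockProj blk k y ∈ W := by
    apply hWsupp
    intro i hi
    rw [blockProj_apply, if_neg hi]
  rw [← heq, Submodule.mem_map] at hyW
  obtain ⟨d, hd, hdy⟩ := hyW
  -- and `y − d ∈ A ⊆ Y` has block `k` zero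
  have hzA : (-d) +ᵥ y ∈ A := AffineSubspace.vadd_mem_of_mem_direction (A.direction.neg_mem hd) hyA
  have hzero : ∀ i, blk i = k → ((-d) +ᵥ y) i = 0 := by
    rw [← blockProj_eq_zero_iff, vadd_eq_add, map_add, map_neg, hdy, neg_add_cancel]
  have hpos : 0 < zcount blk k Y := by
    unfold zcount
    exact Finset.card_pos.mpr ⟨_, Finset.mem_filter.mpr ⟨hAY _ hzA, hzero⟩⟩
  omega

end Summit.PneNP.PneNP.Theorems.ClusCoordSliceZeroFree

namespace Summit.PneNP.PneNP.Theorems.ClusCoord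

open Finset
open Summit.PneNP.PneNP.Theorems.ClusCoordGauge (Twisted peelBlock_slices_of_twisted_le)
open Summit.PneNP.PneNP.Theorems.ClusCoordSliceZeroFree (not_twisted_of_zcount_eq_zero)

open scoped Classical in
/-- **Registered stub `stub_sliceZeroFreeBlock` of path `coord`** (stmt-PneNP-19683, skeleton v12): if a nonempty block `k` has no zero on
`Y`, the slices of block `k` form a block layer family satisfying the block layer inequality (no point is fully `k`-twisted, so the landed gauge
bound `ClusCoordGauge.peelBlock_slices_of_twisted_le` applies with `0 ≤ 2^{bsize k}·0`). -/
theorem stub_sliceZeroFreeBlock : ∀ M n : ℕ, ∀ blk : Fin M → Fin n, ∀ Y : Finset (Fin M → ZMod 2), ∀ k : Fin n,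
    ∀ M' : ℕ, ∀ h : (univ.filter fun i => blk i ≠ k).card = M', 0 < bsize blk k → zcount blk k Y = 0 →
      ∃ L : List (Finset (Fin M' → ZMod 2)), IsBLayerFamily blk Y k M' h L ∧ BLayerIneq M n blk Y k M' L := by
  intro M n blk Y k M' h _ hz
  apply peelBlock_slices_of_twisted_le blk Y k M' h
  have hempty : (Y.filter (Twisted blk Y k M' h 0)).card = 0 := by
    rw [Finset.card_eq_zero, Finset.filter_eq_empty_iff]
    intro y hy
    exact not_twisted_of_zcount_eq_zero blk Y k h hz y hy
  rw [hempty, hz]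
  simp

end Summit.PneNP.PneNP.Theorems.ClusCoord
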